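import Summits.QuantumFields.YangMills.Theorems.IR.EsPolymerTorusCells

/-!
# Crux `IR` (item stmt-QuantumFields-19354) — line «es-polymer-decoupling», rung `stub_esRung`: THE EDWARDS–SOKAL /
KANDEL–DOMANY SUB-MEASURES of the torus Wilson measure and their masses (clause (P))

Helper module for item `stmt-QuantumFields-19354` (`--supports … --as helper`; it closes nothing; lead prover
ym-ir-line-mxc-p1 g2).  With a floor `0 < m ≤ W_c` for the cell Boltzmann factors (`Theorems/IR/EsPolymerTorusCells.lean`):

* §1 cell factors `g_c = W_c/m − 1 ≥ 0` (`cellFactor`), polymer factors `F_γ = ∏_{c∈γ} g_c` (`polyFactor`),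
  `e^{−β S_W} = m^{#cells} ∏_c (1 + g_c)` and the deletion expansion `∏_c (1 + g_c) = ∑_ω F_ω` (`Finset.prod_one_add`);
* §2 the normaliser `esZ = ∫ ∏(1+g_c) dHaar > 0`, activities `esAct γ = ∫ F_γ dHaar ∈ [0, t^{#γ}]` (`t ≥ g_c`), the
  sub-measures `esSub' ω = (F_ω / esZ) · Haar` and `esSub Γ = ∑_{ω : components₆(ω) = Γ} esSub' ω` (components for
  `cellDist ≤ 6`, tree `rcomponents`), with **`∑_Γ esSub Γ = wilsonMeasure ρ β`** (`sum_esSub`);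
* §3 the component family of ANY cell set is `Compatible` (`compatible_rcomponents`), and a compatible family is the
  component family of exactly one set, its union (`filter_rcomponents_eq_of_compatible`); hence `esSub Γ = 0` off the
  compatible families and **(P)** `esSub Γ (1) = esZ⁻¹ ∏_{γ∈Γ} esAct γ` on them (`mass_esSub`) — the product over the
  family by finite-range independence (`integral_prod_polyFactor`, cells of distinct polymers are `≥ 7` apart).

HONEST FRAMING: the strong-coupling graphical decomposition of a finite-torus Wilson measure; no claim beyond it. -/

set_option autoImplicit false

noncomputable section

open MeasureTheory ProbabilityTheory Finset Function
open scoped NNReal ENNReal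
open Literature.MathematicalPhysics.QuantumFieldTheory
open Literature.Probability.LatticeModels (rcomponents rcomponent mem_rcomponents_iff biUnion_rcomponents
  rcomponents_biUnion_eq eq_of_touches_rcomponent isRConnected_rcomponent rcomponent_subset IsRConnected Touches GeomInc
  IsCompatible)

namespace Summit.QuantumFields.YangMills.Cruxes.IR.EsPolymer

open Fin.CommRing in
/-- `cellDist c c = 0`. -/
theorem cellDist_self {q : ℕ} (c : Cell q) : cellDist c c = 0 := by
  rcases Nat.eq_zero_or_pos q with hq | hq
  · subst hq; exact (c 0).elim0
  haveI : NeZero q := ⟨hq.ne'⟩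
  simp [cellDist, cycAbs, sub_self]

variable {N : ℕ} [NeZero N] {G : Type} [Group G] [TopologicalSpace G] [IsTopologicalGroup G] [CompactSpace G]
  [MeasurableSpace G] [BorelSpace G] {n : ℕ} (ρ : G →* Matrix (Fin n) (Fin n) ℂ) (β m : ℝ)

/-! ## §1 Cell factors, polymer factors, the deletion expansion -/

/-- The cell factor `g_c = W_c / m − 1` relative to the floor `m`. -/
def cellFactor (c : Cell N) (U : GaugeConfig 4 N G) : ℝ := cellWeight ρ β c U / m - 1

/-- The polymer factor `F_γ = ∏_{c ∈ γ} g_c`. -/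
def polyFactor (γ : Finset (Cell N)) (U : GaugeConfig 4 N G) : ℝ := ∏ c ∈ γ, cellFactor ρ β m c U

section Basic

variable {ρ β m}

omit [TopologicalSpace G] [IsTopologicalGroup G] [CompactSpace G] [MeasurableSpace G] [BorelSpace G] in
/-- `0 ≤ g_c` under the floor `m ≤ W_c`. -/
theorem cellFactor_nonneg {c : Cell N} {U : GaugeConfig 4 N G} (hm : 0 < m) (hW : m ≤ cellWeight ρ β c U) :
    0 ≤ cellFactor ρ β m c U := by
  unfold cellFactor; rw [sub_nonneg, le_div_iff₀ hm, one_mul]; exact hW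

omit [TopologicalSpace G] [IsTopologicalGroup G] [CompactSpace G] [MeasurableSpace G] [BorelSpace G] in
/-- `g_c ≤ M/m − 1` under the ceiling `W_c ≤ M`. -/
theorem cellFactor_le {c : Cell N} {U : GaugeConfig 4 N G} {M : ℝ} (hm : 0 < m) (hW : cellWeight ρ β c U ≤ M) :
    cellFactor ρ β m c U ≤ M / m - 1 := by
  unfold cellFactor; exact sub_le_sub_right (div_le_div_of_nonneg_right hW hm.le) _

omit [TopologicalSpace G] [IsTopologicalGroup G] [CompactSpace G] [MeasurableSpace G] [BorelSpace G] in
/-- `0 ≤ F_γ ≤ t^{#γ}` under `m ≤ W ≤ M`, `t = M/m − 1`. -/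
theorem polyFactor_bounds {M : ℝ} (hm : 0 < m) (hW : ∀ (c : Cell N) (U : GaugeConfig 4 N G), m ≤ cellWeight ρ β c U ∧ cellWeight ρ β c U ≤ M)
    (γ : Finset (Cell N)) (U : GaugeConfig 4 N G) :
    0 ≤ polyFactor ρ β m γ U ∧ polyFactor ρ β m γ U ≤ (M / m - 1) ^ γ.card := by
  unfold polyFactor
  refine ⟨prod_nonneg fun c _ => cellFactor_nonneg hm (hW c U).1, ?_⟩
  calc ∏ c ∈ γ, cellFactor ρ β m c U ≤ ∏ _c ∈ γ, (M / m - 1) :=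
        prod_le_prod (fun c _ => cellFactor_nonneg hm (hW c U).1) fun c _ => cellFactor_le hm (hW c U).2
    _ = (M / m - 1) ^ γ.card := prod_const _

omit [CompactSpace G] in
/-- `g_c` is measurable. -/
theorem measurable_cellFactor (hρ : Continuous ρ) (c : Cell N) : Measurable (cellFactor (N := N) ρ β m c) :=
  ((measurable_cellWeight ρ β hρ c).div_const m).sub_const 1

omit [CompactSpace G] in
/-- `F_γ` is measurable. -/
theorem measurable_polyFactor (hρ : Continuous ρ) (γ : Finset (Cell N)) : Measurable (polyFactor (N := N) ρ β m γ) :=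
  Finset.measurable_prod γ fun c _ => measurable_cellFactor hρ c

omit [TopologicalSpace G] [IsTopologicalGroup G] [CompactSpace G] [MeasurableSpace G] [BorelSpace G] in
/-- `F_γ` reads only the links of the cells of `γ`. -/
theorem dependsOn_polyFactor (γ : Finset (Cell N)) :
    DependsOn (polyFactor (G := G) ρ β m γ) (↑(γ.biUnion cellLinks) : Set (Edge 4 N)) := by
  intro U V h
  unfold polyFactor cellFactor
  refine prod_congr rfl fun c hc => ?_
  rw [dependsOn_cellWeight ρ β c fun e he => h e (Finset.mem_coe.2 (Finset.mem_biUnion.2 ⟨c, hc, Finset.mem_coe.1 he⟩))]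

omit [CompactSpace G] in
/-- `F_γ` is measurable for the link σ-algebra of the cells of `γ`. -/
theorem measurable_polyFactor_cells (hρ : Continuous ρ) (γ : Finset (Cell N)) :
    Measurable[⨆ c ∈ γ, cylinderEvents (X := fun _ : Edge 4 N => G) (↑(cellLinks c) : Set (Edge 4 N))]
      (polyFactor (N := N) ρ β m γ) :=
  measurable_iSup_of_dependsOn (measurable_polyFactor hρ γ) (dependsOn_polyFactor γ)

omit [TopologicalSpace G] [IsTopologicalGroup G] [CompactSpace G] [MeasurableSpace G] [BorelSpace G] in
/-- **`e^{−βS} = m^{#cells} ∏_c (1 + g_c)`.** -/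
theorem exp_neg_mul_wilsonAction_eq (hm : m ≠ 0) (U : GaugeConfig 4 N G) :
    Real.exp (-β * wilsonAction ρ U) = m ^ Fintype.card (Cell N) * ∏ c, (1 + cellFactor ρ β m c U) := by
  rw [← prod_cellWeight ρ β U]
  have : ∀ c, cellWeight ρ β c U = m * (1 + cellFactor ρ β m c U) := fun c => by
    unfold cellFactor; field_simp; ring
  simp_rw [this, prod_mul_distrib, prod_const, card_univ]

omit [TopologicalSpace G] [IsTopologicalGroup G] [CompactSpace G] [MeasurableSpace G] [BorelSpace G] in
/-- **The deletion expansion** `∏_c (1 + g_c) = ∑_ω F_ω`. -/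
theorem prod_one_add_cellFactor (U : GaugeConfig 4 N G) :
    ∏ c, (1 + cellFactor ρ β m c U) = ∑ ω : Finset (Cell N), polyFactor ρ β m ω U := by
  rw [prod_one_add, powerset_univ]; rfl

end Basic

/-! ## §2 Normaliser, activities, sub-measures -/

/-- The normaliser `esZ = ∫ ∏_c (1 + g_c) dHaar`. -/
def esZ : ℝ := ∫ U, ∏ c : Cell N, (1 + cellFactor ρ β m c U) ∂(Measure.pi fun _ : Edge 4 N => haarProbability G)

/-- The activity of a cell set: `esAct γ = ∫ F_γ dHaar`. -/
def esAct (γ : Finset (Cell N)) : ℝ := ∫ U, polyFactor ρ β m γ U ∂(Measure.pi fun _ : Edge 4 N => haarProbability G)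

/-- The sub-measure of a RETAINED SET `ω`: `(F_ω / esZ) · Haar`. -/
def esSub' (ω : Finset (Cell N)) : Measure (GaugeConfig 4 N G) :=
  (Measure.pi fun _ : Edge 4 N => haarProbability G).withDensity fun U =>
    ((polyFactor ρ β m ω U / esZ (N := N) ρ β m).toNNReal : ℝ≥0∞)

open Classical in
/-- The sub-measure of a FAMILY `Γ`: the sum of `esSub' ω` over the retained sets whose `cellDist ≤ 6`-components
are `Γ`. -/
def esSub (Γ : Finset (Finset (Cell N))) : Measure (GaugeConfig 4 N G) :=
  ∑ ω ∈ Finset.univ.filter (fun ω => rcomponents (fun x y : Cell N => cellDist x y ≤ 6) ω = Γ), esSub' ρ β m ω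

section Measures

variable {ρ β m}

/-- `esZ ≥ 1 > 0` when the cell factors are nonnegative. -/
theorem one_le_esZ (hρ : Continuous ρ) (hm : 0 < m) (hW : ∀ (c : Cell N) (U : GaugeConfig 4 N G), m ≤ cellWeight ρ β c U)
    {t : ℝ} (ht : ∀ (c : Cell N) (U : GaugeConfig 4 N G), cellFactor ρ β m c U ≤ t) : 1 ≤ esZ (N := N) ρ β m := by
  unfold esZ
  have hmeas : Measurable fun U : GaugeConfig 4 N G => ∏ c : Cell N, (1 + cellFactor ρ β m c U) :=
    Finset.measurable_prod _ fun c _ => measurable_const.add (measurable_cellFactor hρ c)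
  have hbd : ∀ U : GaugeConfig 4 N G, |∏ c : Cell N, (1 + cellFactor ρ β m c U)| ≤ (1 + t) ^ Fintype.card (Cell N) :=
    fun U => by
      rw [abs_of_nonneg (prod_nonneg fun c _ => by linarith [cellFactor_nonneg hm (hW c U)])]
      calc ∏ c : Cell N, (1 + cellFactor ρ β m c U) ≤ ∏ _c : Cell N, (1 + t) :=
            prod_le_prod (fun c _ => by linarith [cellFactor_nonneg hm (hW c U)]) fun c _ => by linarith [ht c U]
        _ = (1 + t) ^ Fintype.card (Cell N) := by rw [prod_const, card_univ]
  have h1 : ∀ U : GaugeConfig 4 N G, (1 : ℝ) ≤ ∏ c : Cell N, (1 + cellFactor ρ β m c U) := fun U => by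
    calc (1 : ℝ) = ∏ _c : Cell N, (1 : ℝ) := by simp
      _ ≤ _ := prod_le_prod (fun _ _ => zero_le_one) fun c _ => by linarith [cellFactor_nonneg hm (hW c U)]
  calc (1 : ℝ) = ∫ _U, (1 : ℝ) ∂(Measure.pi fun _ : Edge 4 N => haarProbability G) := by simp
    _ ≤ _ := integral_mono (integrable_const _)
        (Integrable.of_bound hmeas.aestronglyMeasurable _ (ae_of_all _ fun U => by rw [Real.norm_eq_abs]; exact hbd U)) h1

/-- **`0 ≤ esAct γ ≤ t^{#γ}`** (clause (P)'s activity bound with `t ≤ p`). -/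
theorem esAct_bounds (hm : 0 < m) {M : ℝ}
    (hW : ∀ (c : Cell N) (U : GaugeConfig 4 N G), m ≤ cellWeight ρ β c U ∧ cellWeight ρ β c U ≤ M) (γ : Finset (Cell N)) :
    0 ≤ esAct (N := N) ρ β m γ ∧ esAct (N := N) ρ β m γ ≤ (M / m - 1) ^ γ.card := by
  unfold esAct
  refine ⟨integral_nonneg fun U => (polyFactor_bounds hm hW γ U).1, ?_⟩
  calc ∫ U, polyFactor ρ β m γ U ∂(Measure.pi fun _ : Edge 4 N => haarProbability G)
      ≤ ∫ _U, (M / m - 1) ^ γ.card ∂(Measure.pi fun _ : Edge 4 N => haarProbability G) :=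
        integral_mono_of_nonneg (ae_of_all _ fun U => (polyFactor_bounds hm hW γ U).1) (integrable_const _)
          (ae_of_all _ fun U => (polyFactor_bounds hm hW γ U).2)
    _ = (M / m - 1) ^ γ.card := by simp

/-! ### The sub-measures sum to the Wilson measure -/

/-- The torus Wilson measure as the product Haar measure with density `∏(1+g_c)/esZ`. -/
theorem wilsonMeasure_eq_withDensity (hρ : Continuous ρ) (hm : 0 < m) (hW : ∀ (c : Cell N) (U : GaugeConfig 4 N G), m ≤ cellWeight ρ β c U)
    {t : ℝ} (ht : ∀ (c : Cell N) (U : GaugeConfig 4 N G), cellFactor ρ β m c U ≤ t) :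
    wilsonMeasure (d := 4) (L := N) ρ β =
      (Measure.pi fun _ : Edge 4 N => haarProbability G).withDensity fun U =>
        (((∏ c : Cell N, (1 + cellFactor ρ β m c U)) / esZ (N := N) ρ β m).toNNReal : ℝ≥0∞) := by
  set μ₀ : Measure (GaugeConfig 4 N G) := Measure.pi fun _ : Edge 4 N => haarProbability G with hμ₀
  set K : ℕ := Fintype.card (Cell N) with hK
  have hP0 : ∀ U : GaugeConfig 4 N G, 0 ≤ ∏ c : Cell N, (1 + cellFactor ρ β m c U) := fun U =>
    prod_nonneg fun c _ => by linarith [cellFactor_nonneg hm (hW c U)]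
  have hPm : Measurable fun U : GaugeConfig 4 N G => ∏ c : Cell N, (1 + cellFactor ρ β m c U) :=
    Finset.measurable_prod _ fun c _ => measurable_const.add (measurable_cellFactor hρ c)
  have hPb : ∀ U : GaugeConfig 4 N G, |∏ c : Cell N, (1 + cellFactor ρ β m c U)| ≤ (1 + t) ^ K := fun U => by
    rw [abs_of_nonneg (hP0 U)]
    calc ∏ c : Cell N, (1 + cellFactor ρ β m c U) ≤ ∏ _c : Cell N, (1 + t) :=
          prod_le_prod (fun c _ => by linarith [cellFactor_nonneg hm (hW c U)]) fun c _ => by linarith [ht c U]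
      _ = (1 + t) ^ K := by rw [prod_const, card_univ]
  have hZ : 0 < esZ (N := N) ρ β m := lt_of_lt_of_le zero_lt_one (one_le_esZ hρ hm hW ht)
  have hmK : 0 < m ^ K := pow_pos hm _
  have hdens : ∀ U : GaugeConfig 4 N G,
      Real.exp (-β * wilsonAction ρ U) = m ^ K * ∏ c : Cell N, (1 + cellFactor ρ β m c U) :=
    fun U => exp_neg_mul_wilsonAction_eq hm.ne' U
  have hPi : Integrable (fun U : GaugeConfig 4 N G => ∏ c : Cell N, (1 + cellFactor ρ β m c U)) μ₀ :=
    Integrable.of_bound hPm.aestronglyMeasurable _ (ae_of_all _ fun U => by rw [Real.norm_eq_abs]; exact hPb U)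
  have hZW : partitionFunction (d := 4) (L := N) ρ β = ENNReal.ofReal (m ^ K * esZ (N := N) ρ β m) := by
    simp only [partitionFunction, wilsonWeight, withDensity_apply _ MeasurableSet.univ, Measure.restrict_univ]
    simp_rw [hdens]
    rw [← hμ₀, ← ofReal_integral_eq_lintegral_ofReal (hPi.const_mul _)
      (ae_of_all _ fun U => mul_nonneg hmK.le (hP0 U)), integral_const_mul]
    rfl
  have hfun : (fun U : GaugeConfig 4 N G => ENNReal.ofReal (Real.exp (-β * wilsonAction ρ U))) =
      fun U => ENNReal.ofReal (m ^ K * ∏ c : Cell N, (1 + cellFactor ρ β m c U)) := funext fun U => by rw [hdens]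
  have hmeas : Measurable fun U : GaugeConfig 4 N G => ENNReal.ofReal (m ^ K * ∏ c : Cell N, (1 + cellFactor ρ β m c U)) :=
    ENNReal.measurable_ofReal.comp (hPm.const_mul _)
  rw [wilsonMeasure, hZW, wilsonWeight, hfun, ← hμ₀, ← withDensity_smul _ hmeas]
  congr 1
  funext U
  simp only [Pi.smul_apply, smul_eq_mul]
  rw [← ENNReal.div_eq_inv_mul, ← ENNReal.ofReal_div_of_pos (mul_pos hmK hZ), mul_div_mul_left _ _ hmK.ne']
  rfl

/-- **The sub-measures of the retained sets sum to the Wilson measure.** -/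
theorem sum_esSub' (hρ : Continuous ρ) (hm : 0 < m) {M : ℝ}
    (hW : ∀ (c : Cell N) (U : GaugeConfig 4 N G), m ≤ cellWeight ρ β c U ∧ cellWeight ρ β c U ≤ M) :
    ∑ ω : Finset (Cell N), esSub' (N := N) ρ β m ω = wilsonMeasure (d := 4) (L := N) ρ β := by
  set μ₀ : Measure (GaugeConfig 4 N G) := Measure.pi fun _ : Edge 4 N => haarProbability G with hμ₀
  have hW1 : ∀ (c : Cell N) (U : GaugeConfig 4 N G), m ≤ cellWeight ρ β c U := fun c U => (hW c U).1
  have ht : ∀ (c : Cell N) (U : GaugeConfig 4 N G), cellFactor ρ β m c U ≤ M / m - 1 := fun c U => cellFactor_le hm (hW c U).2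
  have hZ : 0 < esZ (N := N) ρ β m := lt_of_lt_of_le zero_lt_one (one_le_esZ hρ hm hW1 ht)
  rw [wilsonMeasure_eq_withDensity hρ hm hW1 ht]
  -- finite sums of densities
  have hmeasd : ∀ ω : Finset (Cell N), Measurable fun U : GaugeConfig 4 N G =>
      ((polyFactor ρ β m ω U / esZ (N := N) ρ β m).toNNReal : ℝ≥0∞) := fun ω =>
    ENNReal.measurable_ofReal.comp ((measurable_polyFactor hρ ω).div_const _)
  have key : ∀ s : Finset (Finset (Cell N)), ∑ ω ∈ s, esSub' (N := N) ρ β m ω =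
      μ₀.withDensity fun U => ∑ ω ∈ s, ((polyFactor ρ β m ω U / esZ (N := N) ρ β m).toNNReal : ℝ≥0∞) := by
    intro s
    induction s using Finset.induction_on with
    | empty => simp
    | insert ω s hω ih =>
      rw [sum_insert hω, ih]
      have : (fun U => ∑ ω' ∈ insert ω s, ((polyFactor ρ β m ω' U / esZ (N := N) ρ β m).toNNReal : ℝ≥0∞)) =
          (fun U => ((polyFactor ρ β m ω U / esZ (N := N) ρ β m).toNNReal : ℝ≥0∞)) +
            fun U => ∑ ω' ∈ s, ((polyFactor ρ β m ω' U / esZ (N := N) ρ β m).toNNReal : ℝ≥0∞) := by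
        funext U; simp [sum_insert hω]
      rw [this, withDensity_add_left (hmeasd ω)]
      rfl
  rw [key]
  congr 1
  funext U
  have h0 : ∀ ω : Finset (Cell N), 0 ≤ polyFactor ρ β m ω U / esZ (N := N) ρ β m := fun ω =>
    div_nonneg (polyFactor_bounds hm hW ω U).1 hZ.le
  change ∑ ω : Finset (Cell N), ENNReal.ofReal (polyFactor ρ β m ω U / esZ (N := N) ρ β m) =
    ENNReal.ofReal ((∏ c : Cell N, (1 + cellFactor ρ β m c U)) / esZ (N := N) ρ β m)
  rw [← ENNReal.ofReal_sum_of_nonneg fun ω _ => h0 ω, ← sum_div, prod_one_add_cellFactor]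

/-- **`∑_Γ esSub Γ = wilsonMeasure ρ β`** (fibrewise over the component map). -/
theorem sum_esSub (hρ : Continuous ρ) (hm : 0 < m) {M : ℝ}
    (hW : ∀ (c : Cell N) (U : GaugeConfig 4 N G), m ≤ cellWeight ρ β c U ∧ cellWeight ρ β c U ≤ M) :
    Finset.univ.sum (esSub (N := N) ρ β m) = wilsonMeasure (d := 4) (L := N) ρ β := by
  classical
  rw [← sum_esSub' hρ hm hW]
  unfold esSub
  exact sum_fiberwise_of_maps_to (fun ω _ => mem_univ _) _

/-! ## §3 Components and compatibility; the masses (clause (P)) -/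

omit [NeZero N] in
/-- The `cellDist ≤ 6`-components of ANY cell set form a compatible family of polymers. -/
theorem compatible_rcomponents (ω : Finset (Cell N)) :
    Compatible (rcomponents (fun x y : Cell N => cellDist x y ≤ 6) ω) := by
  have hR : ∀ x y : Cell N, cellDist x y ≤ 6 → cellDist y x ≤ 6 := fun x y h => by rwa [cellDist_comm]
  refine ⟨fun X hX => ?_, fun X hX Y hY hne c hc c' hc' => ?_⟩
  · obtain ⟨p, hp, rfl⟩ := mem_rcomponents_iff.1 hX
    have hc := isRConnected_rcomponent hR hp
    exact ⟨hc.1, fun c hc1 c' hc2 => Relation.ReflTransGen.mono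
      (fun x y (h : cellDist x y ≤ 6 ∧ x ∈ rcomponent (fun x y : Cell N => cellDist x y ≤ 6) ω p ∧
          y ∈ rcomponent (fun x y : Cell N => cellDist x y ≤ 6) ω p) =>
        (⟨h.2.1, h.2.2, h.1⟩ : x ∈ rcomponent (fun x y : Cell N => cellDist x y ≤ 6) ω p ∧
          y ∈ rcomponent (fun x y : Cell N => cellDist x y ≤ 6) ω p ∧ cellDist x y ≤ 6)) _ _ (hc.2 c hc1 c' hc2)⟩
  · by_contra hlt
    rw [not_le] at hlt
    obtain ⟨p, hp, rfl⟩ := mem_rcomponents_iff.1 hX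
    obtain ⟨p', hp', rfl⟩ := mem_rcomponents_iff.1 hY
    exact hne (eq_of_touches_rcomponent hR ⟨c, hc, c', hc', Or.inr (by omega)⟩)

omit [NeZero N] in
/-- A compatible family is the component family of exactly one cell set: its union. -/
theorem filter_rcomponents_eq_of_compatible {Γ : Finset (Finset (Cell N))} (hΓ : Compatible Γ) :
    Finset.univ.filter (fun ω => rcomponents (fun x y : Cell N => cellDist x y ≤ 6) ω = Γ) = {Γ.biUnion id} := by
  classical
  have hconn : ∀ X ∈ Γ, IsRConnected (fun x y : Cell N => cellDist x y ≤ 6) X := fun X hX =>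
    ⟨(hΓ.1 X hX).1, fun c hc c' hc' =>
      Relation.ReflTransGen.mono (fun x y (h : x ∈ X ∧ y ∈ X ∧ cellDist x y ≤ 6) =>
        (⟨h.2.2, h.1, h.2.1⟩ : cellDist x y ≤ 6 ∧ x ∈ X ∧ y ∈ X)) _ _ ((hΓ.1 X hX).2 c hc c' hc')⟩
  have hcomp : IsCompatible (GeomInc fun x y : Cell N => cellDist x y ≤ 6) Γ := by
    intro X hX Y hY hne hinc
    rcases hinc with h | ⟨w, hw, q, hq, h⟩
    · exact hne h
    · have h7 := hΓ.2 X hX Y hY hne w hw q hq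
      rcases h with rfl | h
      · have := cellDist_self w; omega
      · omega
  ext ω
  simp only [mem_filter, mem_univ, true_and, mem_singleton]
  constructor
  · intro h; rw [← h, biUnion_rcomponents]
  · rintro rfl; exact rcomponents_biUnion_eq hconn hcomp

/-- Off the compatible families the sub-measure vanishes. -/
theorem esSub_eq_zero_of_not_compatible {Γ : Finset (Finset (Cell N))} (hΓ : ¬ Compatible Γ) :
    esSub (N := N) ρ β m Γ = 0 := by
  classical
  unfold esSub
  refine sum_eq_zero fun ω hω => ?_
  exact absurd ((mem_filter.1 hω).2 ▸ compatible_rcomponents ω) hΓ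

/-- On a compatible family the sub-measure is that of its union. -/
theorem esSub_eq_of_compatible {Γ : Finset (Finset (Cell N))} (hΓ : Compatible Γ) :
    esSub (N := N) ρ β m Γ = esSub' ρ β m (Γ.biUnion id) := by
  classical
  unfold esSub
  rw [filter_rcomponents_eq_of_compatible hΓ, sum_singleton]

omit [TopologicalSpace G] [IsTopologicalGroup G] [CompactSpace G] [MeasurableSpace G] [BorelSpace G] in
/-- The polymer factor of a disjoint union is the product of the polymer factors. -/
theorem polyFactor_biUnion {Γ : Finset (Finset (Cell N))} (hΓ : Compatible Γ) (U : GaugeConfig 4 N G) :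
    polyFactor ρ β m (Γ.biUnion id) U = ∏ γ ∈ Γ, polyFactor ρ β m γ U := by
  unfold polyFactor
  have hdisj : (↑Γ : Set (Finset (Cell N))).PairwiseDisjoint id := by
    intro X hX Y hY hne
    rw [Function.onFun, id, id, Finset.disjoint_left]
    intro c hcX hcY
    have h7 := hΓ.2 X hX Y hY hne c hcX c hcY
    have := cellDist_self c
    omega
  rw [prod_biUnion hdisj]; rfl

/-- **Factorisation of the activities over a compatible family** (finite-range independence: the cells of distinct polymers
are at distance `≥ 7 ≥ 2`). -/
theorem integral_prod_polyFactor (hρ : Continuous ρ) {Γ : Finset (Finset (Cell N))} (hΓ : Compatible Γ) :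
    ∫ U, ∏ γ ∈ Γ, polyFactor ρ β m γ U ∂(Measure.pi fun _ : Edge 4 N => haarProbability G) =
      ∏ γ ∈ Γ, esAct (N := N) ρ β m γ := by
  classical
  -- induction over sub-families of `Γ`
  suffices h : ∀ s : Finset (Finset (Cell N)), s ⊆ Γ →
      ∫ U, ∏ γ ∈ s, polyFactor ρ β m γ U ∂(Measure.pi fun _ : Edge 4 N => haarProbability G) =
        ∏ γ ∈ s, esAct (N := N) ρ β m γ from h Γ subset_rfl
  intro s
  induction s using Finset.induction_on with
  | empty => intro; simp
  | insert γ s hγs ih =>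
    intro hs
    have hγ : γ ∈ Γ := hs (mem_insert_self _ _)
    have hs' : s ⊆ Γ := fun x hx => hs (mem_insert_of_mem hx)
    simp_rw [prod_insert hγs]
    rw [← ih hs']
    -- the remaining product is the polymer factor of the union of `s`
    have hsc : Compatible s := ⟨fun X hX => hΓ.1 X (hs' hX), fun X hX Y hY => hΓ.2 X (hs' hX) Y (hs' hY)⟩
    have hprod : ∀ U : GaugeConfig 4 N G, ∏ γ' ∈ s, polyFactor ρ β m γ' U = polyFactor ρ β m (s.biUnion id) U :=
      fun U => (polyFactor_biUnion hsc U).symm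
    simp_rw [hprod]
    refine integral_mul_eq_of_cells (haarProbability G) (K₁ := γ) (K₂ := s.biUnion id) ?_
      (measurable_polyFactor_cells hρ γ) (measurable_polyFactor_cells hρ (s.biUnion id))
    intro c hc c' hc'
    obtain ⟨γ', hγ', hc'γ⟩ := mem_biUnion.1 hc'
    have hne : γ ≠ γ' := fun h => hγs (h ▸ hγ')
    have := hΓ.2 γ hγ γ' (hs' hγ') hne c hc c' hc'γ
    omega

/-- **Clause (P): the mass of a compatible family** `esSub Γ (1) = esZ⁻¹ ∏_{γ∈Γ} esAct γ`. -/
theorem mass_esSub (hρ : Continuous ρ) (hm : 0 < m) {M : ℝ}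
    (hW : ∀ (c : Cell N) (U : GaugeConfig 4 N G), m ≤ cellWeight ρ β c U ∧ cellWeight ρ β c U ≤ M) {Γ : Finset (Finset (Cell N))}
    (hΓ : Compatible Γ) :
    (esSub (N := N) ρ β m Γ Set.univ).toReal = (esZ (N := N) ρ β m)⁻¹ * ∏ γ ∈ Γ, esAct (N := N) ρ β m γ := by
  have hZ : 0 < esZ (N := N) ρ β m :=
    lt_of_lt_of_le zero_lt_one (one_le_esZ hρ hm (fun c U => (hW c U).1) fun c U => cellFactor_le hm (hW c U).2)
  rw [esSub_eq_of_compatible hΓ, esSub', withDensity_apply _ MeasurableSet.univ, Measure.restrict_univ]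
  have h0 : ∀ U : GaugeConfig 4 N G, 0 ≤ polyFactor ρ β m (Γ.biUnion id) U / esZ (N := N) ρ β m := fun U =>
    div_nonneg (polyFactor_bounds hm hW _ U).1 hZ.le
  have hint : Integrable (fun U : GaugeConfig 4 N G => polyFactor ρ β m (Γ.biUnion id) U / esZ (N := N) ρ β m)
      (Measure.pi fun _ : Edge 4 N => haarProbability G) :=
    Integrable.of_bound ((measurable_polyFactor hρ _).div_const _).aestronglyMeasurable
      ((M / m - 1) ^ (Γ.biUnion id).card / esZ (N := N) ρ β m) (ae_of_all _ fun U => by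
        rw [Real.norm_eq_abs, abs_of_nonneg (h0 U)]
        exact div_le_div_of_nonneg_right (polyFactor_bounds hm hW _ U).2 hZ.le)
  rw [lintegral_coe_eq_integral _ (by simpa [Real.coe_toNNReal _ (h0 _)] using hint), ENNReal.toReal_ofReal
    (integral_nonneg fun U => by positivity)]
  simp_rw [Real.coe_toNNReal _ (h0 _)]
  rw [integral_div]
  simp_rw [polyFactor_biUnion hΓ]
  rw [integral_prod_polyFactor hρ hΓ, div_eq_inv_mul]

end Measures

end Summit.QuantumFields.YangMills.Cruxes.IR.EsPolymer

end
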